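import Mathlib.LinearAlgebra.QuadraticForm.Signature
import Mathlib.Data.Real.Basic
import Mathlib.Algebra.Algebra.Rat
import HarnessLib

/-!
# The index of inertia is invariant under extension of the ordered ground field

Topic `LinearAlgebra/QuadraticForm`; namespace `Literature.LinearAlgebra.QuadraticForm`. KERNEL
mathematics only (theorems, no definition, no named fact).

Let `K ⊆ L` be ordered fields with `K → L` order preserving (e.g. `ℚ ⊆ ℝ`), `(W, B_K)` a
finite-dimensional symmetric bilinear space over `K` and `(V, B_L)` one over `L`, and `f : W → V` an
additive map with `B_L(f a, f b) = B_K(a, b)` (read in `L`) carrying `K`-linearly independent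
families to `L`-linearly independent ones, with `dim_L V = dim_K W` — i.e. `(V, B_L)` is the base
change `(W, B_K) ⊗_K L` presented inside an ambient `L`-space. Then

* `sigPos_sigNeg_eq_of_baseChange` — **`b⁺(B_L) = b⁺(B_K)` and `b⁻(B_L) = b⁻(B_K)`**.

Proof: a `B_K`-orthogonal `K`-basis `v` of `W` (`LinearMap.BilinForm.exists_orthogonal_basis`)
diagonalises `B_K` with weights `wᵢ = B_K(vᵢ, vᵢ)`; its image `f ∘ v` is an `L`-basis of `V`
(independent of the right cardinality), `B_L`-orthogonal with weights `wᵢ` read in `L`; by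
Sylvester's law of inertia (`QuadraticForm.sigPos_of_equiv_weightedSumSquares`: the number of
positive weights of ANY diagonalisation is `b⁺`) both indices count the same positive (negative)
weights. This is the statement that lets a signature computed over `ℝ` (Hodge index theorems) be
read on rational coefficients.

## References

* [Lang1987LinearAlgebra] S. Lang, Linear Algebra (3rd ed., 1987), Ch. V §8 Thm. 8.2 (Sylvester's
  theorem: the index does not depend on the orthogonal basis), PDF pp. 115–116 of the held text.
-/

noncomputable section

open Module QuadraticMap

namespace Literature.LinearAlgebra.QuadraticForm

section BaseChange

variable {K L : Type*} [Field K] [LinearOrder K] [IsStrictOrderedRing K]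
  [Field L] [LinearOrder L] [IsStrictOrderedRing L] [Algebra K L]
  {W : Type*} [AddCommGroup W] [Module K W] [FiniteDimensional K W]
  {V : Type*} [AddCommGroup V] [Module L V] [FiniteDimensional L V]

/-- **The indices of inertia are invariant under base change to a bigger ordered field.** Let
`K → L` be an order-preserving map of ordered fields (an `Algebra K L` with `algebraMap` strictly
monotone), `B_K` a symmetric bilinear form on the finite-dimensional `K`-space `W`, `B_L` a symmetric
bilinear form on the finite-dimensional `L`-space `V`, and `f : W →+ V` additive with
`B_L(f a, f b) = B_K(a, b)` (in `L`), sending `K`-linearly independent families to `L`-linearly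
independent families, `dim_L V = dim_K W`. Then `b⁺(B_L) = b⁺(B_K)` and `b⁻(B_L) = b⁻(B_K)`:
an orthogonal `K`-basis of `W` is carried to an orthogonal `L`-basis of `V` with the same diagonal
weights, and by Sylvester's theorem the index is the number of positive weights of any orthogonal
basis. [cite: Lang1987LinearAlgebra, Ch. V §8 Thm. 8.2] -/
theorem sigPos_sigNeg_eq_of_baseChange (hmono : StrictMono (algebraMap K L))
    (BK : LinearMap.BilinForm K W) (hBK : BK.IsSymm) (BL : LinearMap.BilinForm L V)
    (hBL : BL.IsSymm) (f : W →+ V)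
    (hf : ∀ a b, BL (f a) (f b) = algebraMap K L (BK a b))
    (hli : ∀ (m : ℕ) (v : Fin m → W), LinearIndependent K v → LinearIndependent L (f ∘ v))
    (hdim : Module.finrank L V = Module.finrank K W) :
    sigPos (LinearMap.BilinMap.toQuadraticMap BL) = sigPos (LinearMap.BilinMap.toQuadraticMap BK) ∧
      sigNeg (LinearMap.BilinMap.toQuadraticMap BL) =
        sigNeg (LinearMap.BilinMap.toQuadraticMap BK) := by
  classical
  haveI : Invertible (2 : K) := invertibleOfNonzero two_ne_zero
  haveI : Invertible (2 : L) := invertibleOfNonzero two_ne_zero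
  set QK := LinearMap.BilinMap.toQuadraticMap BK with hQK
  set QL := LinearMap.BilinMap.toQuadraticMap BL with hQL
  have hsK : ∀ x y, BK x y = BK y x := fun x y ↦ hBK.eq x y
  have hsL : ∀ x y, BL x y = BL y x := fun x y ↦ hBL.eq x y
  -- an orthogonal `K`-basis of `W`
  obtain ⟨v, hv⟩ := LinearMap.BilinForm.exists_orthogonal_basis hBK
  have hvK : (QuadraticMap.associated (R := K) QK).IsOrthoᵢ v := by
    rw [hQK, QuadraticMap.associated_left_inverse K hsK]
    exact hv
  have EK : QK.Equivalent (weightedSumSquares K fun i ↦ QK (v i)) := by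
    rw [← QuadraticMap.basisRepr_eq_of_iIsOrtho QK v hvK]
    exact ⟨QK.isometryEquivBasisRepr v⟩
  -- its image, an orthogonal `L`-basis of `V`
  have hu : LinearIndependent L (f ∘ ⇑v) := hli _ v v.linearIndependent
  let u : Basis (Fin (Module.finrank K W)) L V :=
    basisOfLinearIndependentOfCardEqFinrank' (f ∘ ⇑v) hu (by rw [Fintype.card_fin, hdim])
  have hucoe : ∀ i, u i = f (v i) := fun i ↦ by
    simp only [u, coe_basisOfLinearIndependentOfCardEqFinrank', Function.comp_apply]
  have hvL : (QuadraticMap.associated (R := L) QL).IsOrthoᵢ u := by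
    rw [hQL, QuadraticMap.associated_left_inverse L hsL]
    intro i j hij
    show BL (u i) (u j) = 0
    rw [hucoe, hucoe, hf, show BK (v i) (v j) = 0 from hv hij, map_zero]
  have EL : QL.Equivalent (weightedSumSquares L fun i ↦ QL (u i)) := by
    rw [← QuadraticMap.basisRepr_eq_of_iIsOrtho QL u hvL]
    exact ⟨QL.isometryEquivBasisRepr u⟩
  -- the weights agree
  have hw : ∀ i, QL (u i) = algebraMap K L (QK (v i)) := fun i ↦ by
    rw [hQL, hQK, LinearMap.BilinMap.toQuadraticMap_apply, LinearMap.BilinMap.toQuadraticMap_apply,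
      hucoe, hf]
  have hpos : ∀ x : K, 0 < algebraMap K L x ↔ 0 < x := fun x ↦ by
    rw [← map_zero (algebraMap K L)]
    exact hmono.lt_iff_lt
  have hneg : ∀ x : K, algebraMap K L x < 0 ↔ x < 0 := fun x ↦ by
    rw [← map_zero (algebraMap K L)]
    exact hmono.lt_iff_lt
  refine ⟨?_, ?_⟩
  · rw [QuadraticForm.sigPos_of_equiv_weightedSumSquares EL,
      QuadraticForm.sigPos_of_equiv_weightedSumSquares EK]
    congr 1
    ext i
    simp only [Set.mem_setOf_eq, hw, hpos]
  · rw [QuadraticForm.sigNeg_of_equiv_weightedSumSquares EL,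
      QuadraticForm.sigNeg_of_equiv_weightedSumSquares EK]
    congr 1
    ext i
    simp only [Set.mem_setOf_eq, hw, hneg]

/-- The rational-to-real case: `K = ℚ`, `L = ℝ` (`ℚ → ℝ` is strictly monotone).
[cite: Lang1987LinearAlgebra, Ch. V §8 Thm. 8.2] -/
theorem sigPos_sigNeg_eq_of_baseChange_rat_real
    {W : Type*} [AddCommGroup W] [Module ℚ W] [FiniteDimensional ℚ W]
    {V : Type*} [AddCommGroup V] [Module ℝ V] [FiniteDimensional ℝ V]
    (BK : LinearMap.BilinForm ℚ W) (hBK : BK.IsSymm) (BL : LinearMap.BilinForm ℝ V)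
    (hBL : BL.IsSymm) (f : W →+ V)
    (hf : ∀ a b, BL (f a) (f b) = ((BK a b : ℚ) : ℝ))
    (hli : ∀ (m : ℕ) (v : Fin m → W), LinearIndependent ℚ v → LinearIndependent ℝ (f ∘ v))
    (hdim : Module.finrank ℝ V = Module.finrank ℚ W) :
    sigPos (LinearMap.BilinMap.toQuadraticMap BL) = sigPos (LinearMap.BilinMap.toQuadraticMap BK) ∧
      sigNeg (LinearMap.BilinMap.toQuadraticMap BL) =
        sigNeg (LinearMap.BilinMap.toQuadraticMap BK) :=
  sigPos_sigNeg_eq_of_baseChange (K := ℚ) (L := ℝ) Rat.cast_strictMono BK hBK BL hBL f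
    (fun a b ↦ by rw [hf, eq_ratCast]) hli hdim

end BaseChange

end Literature.LinearAlgebra.QuadraticForm

end
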